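import Mathlib
import HarnessLib
import Summits.ValiantsHypothesis.ValiantsHypothesis.Theorems.MonotoneRestorationMonotoneRestorationQPLinearWidthCFIOddCover

/-!
# Route MonotoneRestoration, crux `MonotoneRestorationQP` (stmt-15886), line `linear_width` —
# ODD SUBDIVISIONS DRAWN IN A BIPARTITE PATTERN ARE ODD COVERS (the colour fold)

Helper file (`--supports stmt-ValiantsHypothesis-15886`), def-free.  Companion of `…LinearWidthCFIOddCover` (p841932).

The odd-cover strictness theorem consumes a homomorphism `ρ : S → B₂` with a pseudo-section and alternating chains.  This
file discharges that structure for the situation the supply chain actually produces: a wide base `B` on `Fin v` and, in the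
pattern graph of a bipartite pattern `E`, branch vertices `β u` and for every dart `d = (u,w)` of `B` a CHAIN
`c d : ℕ → Fin a ⊕ Fin b` of pattern edges from `β u` to `β w` of ODD length `2 n_d + 3 ≥ 3` (the chain of the reversed dart
being the reversed chain), whose interior vertices avoid the branch vertices and the interiors of the other edges' chains.
NO injectivity inside a chain and NO position bookkeeping is needed: the pattern graph is bipartite with the canonical colouring
`Sum.isLeft`, colours alternate along a chain, so the fold `ρ` of an interior vertex `x` of the chain of `{u,w}` is read off
its COLOUR — `x ↦ w_{u,w}` if `x` has the colour opposite to `β u`, `x ↦ w_{w,u}` otherwise (`β u`, `β w` have opposite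
colours because the chain is odd) — and `β u ↦ u`.

* `isLeft_of_patternGraph_adj` — pattern edges join the two colour classes;
* **`oddCover_of_chains`** — the data above yield a sub-pattern `E₀ ≤ E` (the chain edges) together with an odd cover
  `ρ₀ : patternGraph E₀ →g subdiv B`, pseudo-section `s₀` (`u ↦ β u`, `(u,w) ↦ c_{(u,w)} 1`) and alternating chains — exactly
  the input of `CFIOddCover.card_hom_cfiGraph_lt_of_oddCover` / `exists_fin_hosts_odd`;
* **`exists_homIndist_affineWitness_of_chains`** — hence, for `B` connected on `≥ 2` vertices with `tw B ≥ k ≥ 1`, a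
  `HomIndist ν k` pair separating `hom_E` at level `ν = |CFI(B)|`;
* **`widthRung_sqrt_of_chains`** — the `√N` rung `WidthRung (fun n => Nat.sqrt n / (3C+3))` from the purely combinatorial
  hypothesis **(CH₂)_{C,g}**: every isolated-free pattern of tree-width `≥ g k` contains such a chain system over a connected
  base `B` with `tw B ≥ k` and `|CFI(B)| ≤ C(a+b+1)`.

Placement (honest label).  (CH₂) is what the Excluded Grid Theorem plus the tree's minor toolkit (`MinorTrans`, p841952;
`PathSubdivision`, p841989 under review) deliver with `B` = a wall whose even-length edges are subdivided once; the remaining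
steps are the drawing of the `5`-subdivided wall in the grid and the concatenation of topological-minor paths [both M].  No stub
closed; θ₁, the cruxes and VP ≠ VNP NOT moved. [cite: Roberson2022, Thm 3.13; ChenFlumLiu2025, Thm 11.1, Thm 12.2; Diestel2010, §1.7]
-/

set_option linter.dupNamespace false

noncomputable section

open scoped Classical

namespace Summit.ValiantsHypothesis.ValiantsHypothesis.Theorems.CFIOddCover

open MvPolynomial
open Literature.ModelTheory.FiniteModelTheory Literature.ModelTheory.FiniteModelTheory.ChenFlumLiu2025
open Literature.Computability.AlgebraicComplexity
open Summit.ValiantsHypothesis.ValiantsHypothesis.Theorems.MonotoneRestorationQPLinearWidth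
open Summit.ValiantsHypothesis.ValiantsHypothesis.Theorems.CFIHomMonotone
open Summit.ValiantsHypothesis.ValiantsHypothesis.Theorems.AffineWitness

/-- Pattern graphs are bipartite with the canonical colouring: an edge joins a row vertex to a column vertex. [folklore] -/
theorem isLeft_of_patternGraph_adj {a b : ℕ} {E : Multiset (Fin a × Fin b)} {x y : Fin a ⊕ Fin b}
    (h : (patternGraph E).Adj x y) : y.isLeft = !x.isLeft := by
  simp only [patternGraph, SimpleGraph.fromRel_adj] at h
  rcases h.2 with ⟨p, -, rfl, rfl⟩ | ⟨p, -, rfl, rfl⟩ <;> rfl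

/-- **ODD SUBDIVISIONS DRAWN IN A PATTERN ARE ODD COVERS (the colour fold).**  Let `B` be a graph on `Fin v` (`v > 0`),
`β` injective branch vertices in the pattern graph of `E`, and for every dart `d` of `B` a chain `c d` of pattern edges of odd
length `2 n_d + 3` from `β d.1.1` to `β d.1.2`, reversed darts carrying reversed chains, interior vertices off the branch
vertices and off the interiors of the chains of other edges.  Then the sub-pattern `E₀ ≤ E` of chain edges oddly covers
`B₂ = subdiv B`. [cite: Roberson2022, Thm 3.13 (oddomorphisms); Diestel2010, §1.7] -/
theorem oddCover_of_chains {v a b : ℕ} (hv : 0 < v) {B : SimpleGraph (Fin v)} (E : Multiset (Fin a × Fin b))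
    (β : Fin v → Fin a ⊕ Fin b) (hβ : Function.Injective β) (n : Dart B → ℕ) (c : Dart B → ℕ → Fin a ⊕ Fin b)
    (hn : ∀ d, n d.rev = n d) (hc0 : ∀ d, c d 0 = β d.1.1)
    (hrev : ∀ d i, i ≤ 2 * n d + 3 → c d.rev i = c d (2 * n d + 3 - i))
    (hadj : ∀ d i, i < 2 * n d + 3 → (patternGraph E).Adj (c d i) (c d (i + 1)))
    (hint : ∀ d i, 0 < i → i < 2 * n d + 3 → ∀ u, c d i ≠ β u)
    (hdisj : ∀ d d' i i', 0 < i → i < 2 * n d + 3 → 0 < i' → i' < 2 * n d' + 3 → c d i = c d' i' →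
      d' = d ∨ d' = d.rev) :
    ∃ E₀ : Multiset (Fin a × Fin b), E₀ ≤ E ∧
      ∃ (ρ₀ : patternGraph E₀ →g subdiv B) (s₀ : Fin v ⊕ Dart B → Fin a ⊕ Fin b), (∀ y, ρ₀ (s₀ y) = y) ∧
        ∀ y y', (subdiv B).Adj y y' →
          ∃ (m : ℕ) (c' : ℕ → Fin a ⊕ Fin b), c' 0 = s₀ y ∧ c' (2 * m + 1) = s₀ y' ∧
            (∀ i, i ≤ 2 * m → (patternGraph E₀).Adj (c' i) (c' (i + 1))) ∧
            (∀ i, i ≤ m → ρ₀ (c' (2 * i)) = y) ∧ (∀ i, i ≤ m → ρ₀ (c' (2 * i + 1)) = y') := by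
  classical
  -- colours alternate along a chain
  have hpar : ∀ (d : Dart B) (i : ℕ), i ≤ 2 * n d + 3 →
      (c d i).isLeft = (if Even i then (β d.1.1).isLeft else !(β d.1.1).isLeft) := by
    intro d i
    induction i with
    | zero => intro _; simp [hc0]
    | succ i ih =>
      intro hi
      rw [isLeft_of_patternGraph_adj (hadj d i (by omega)), ih (by omega)]
      by_cases he : Even i
      · have : ¬ Even (i + 1) := by rw [Nat.even_add_one]; exact not_not.2 he
        simp [he, this]
      · have : Even (i + 1) := by rw [Nat.even_add_one]; exact he
        simp [he, this]
  -- the last vertex of a chain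
  have hcL : ∀ d : Dart B, c d (2 * n d + 3) = β d.1.2 := by
    intro d
    have h := hrev d 0 (Nat.zero_le _)
    rw [hc0, Nat.sub_zero] at h
    rw [← h]
    rfl
  -- the two ends have opposite colours
  have hends : ∀ d : Dart B, (β d.1.2).isLeft = !(β d.1.1).isLeft := by
    intro d
    rw [← hcL d, hpar d _ le_rfl]
    have : ¬ Even (2 * n d + 3) := by
      rw [Nat.not_even_iff_odd]; exact ⟨n d + 1, by ring⟩
    simp [this]
  -- "good" darts of an interior vertex: on the chain and of the colour opposite to the tail
  -- uniqueness of the good dart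
  have huniq : ∀ (d d' : Dart B) (x : Fin a ⊕ Fin b), (∃ i, 0 < i ∧ i < 2 * n d + 3 ∧ c d i = x) → x.isLeft = !(β d.1.1).isLeft →
      (∃ i, 0 < i ∧ i < 2 * n d' + 3 ∧ c d' i = x) → x.isLeft = !(β d'.1.1).isLeft → d' = d := by
    rintro d d' x ⟨i, hi0, hiL, rfl⟩ hcol ⟨i', hi0', hiL', heq⟩ hcol'
    rcases hdisj d d' i i' hi0 hiL hi0' hiL' heq.symm with rfl | rfl
    · rfl
    · exfalso
      have h1 : (β d.rev.1.1).isLeft = !(β d.1.1).isLeft := hends d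
      rw [hcol, h1, Bool.not_not] at hcol'
      exact (Bool.eq_not_self _).1 hcol'.symm
  -- odd interior positions are good for `d`, even ones for `d.rev`
  have hgood_odd : ∀ (d : Dart B) (i : ℕ), i < 2 * n d + 3 → ¬ Even i →
      (∃ j, 0 < j ∧ j < 2 * n d + 3 ∧ c d j = c d i) ∧ (c d i).isLeft = !(β d.1.1).isLeft := by
    intro d i hi hodd
    refine ⟨⟨i, Nat.pos_of_ne_zero (fun h => hodd (h ▸ Even.zero)), hi, rfl⟩, ?_⟩
    rw [hpar d i hi.le]; simp [hodd]
  have hgood_even : ∀ (d : Dart B) (i : ℕ), 0 < i → i < 2 * n d + 3 → Even i →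
      (∃ j, 0 < j ∧ j < 2 * n d.rev + 3 ∧ c d.rev j = c d i) ∧ (c d i).isLeft = !(β d.rev.1.1).isLeft := by
    intro d i hi0 hi hev
    refine ⟨⟨2 * n d + 3 - i, by omega, by rw [hn]; omega, ?_⟩, ?_⟩
    · rw [hrev d _ (by omega)]
      congr 1; omega
    · rw [hpar d i hi.le, if_pos hev]
      show (β d.1.1).isLeft = !(β d.1.2).isLeft
      rw [hends d, Bool.not_not]
  -- interior vertices are not branch vertices
  have hnotβ : ∀ (d : Dart B) (i : ℕ), 0 < i → i < 2 * n d + 3 → ¬ ∃ u, β u = c d i :=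
    fun d i hi0 hi ⟨u, hu⟩ => hint d i hi0 hi u hu.symm
  -- the fold
  let ρf : Fin a ⊕ Fin b → Fin v ⊕ Dart B := fun x =>
    if h : ∃ u, β u = x then .inl h.choose
    else if h' : ∃ d : Dart B, (∃ i, 0 < i ∧ i < 2 * n d + 3 ∧ c d i = x) ∧ x.isLeft = !(β d.1.1).isLeft then .inr h'.choose
    else .inl ⟨0, hv⟩
  have hρβ : ∀ u, ρf (β u) = .inl u := by
    intro u
    have h : ∃ u', β u' = β u := ⟨u, rfl⟩
    simp only [ρf, dif_pos h, Sum.inl.injEq]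
    exact hβ h.choose_spec
  have hρgood : ∀ (d : Dart B) (x : Fin a ⊕ Fin b), (∃ i, 0 < i ∧ i < 2 * n d + 3 ∧ c d i = x) → x.isLeft = !(β d.1.1).isLeft →
      ρf x = .inr d := by
    intro d x hon hcol
    have hnb : ¬ ∃ u, β u = x := by
      obtain ⟨i, hi0, hi, rfl⟩ := hon
      exact hnotβ d i hi0 hi
    have h' : ∃ d : Dart B, (∃ i, 0 < i ∧ i < 2 * n d + 3 ∧ c d i = x) ∧ x.isLeft = !(β d.1.1).isLeft := ⟨d, hon, hcol⟩
    simp only [ρf, dif_neg hnb, dif_pos h', Sum.inr.injEq]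
    exact huniq d _ x hon hcol h'.choose_spec.1 h'.choose_spec.2
  have hρodd : ∀ (d : Dart B) (i : ℕ), i < 2 * n d + 3 → ¬ Even i → ρf (c d i) = .inr d := fun d i hi hodd =>
    hρgood d _ (hgood_odd d i hi hodd).1 (hgood_odd d i hi hodd).2
  have hρeven : ∀ (d : Dart B) (i : ℕ), 0 < i → i < 2 * n d + 3 → Even i → ρf (c d i) = .inr d.rev := fun d i hi0 hi hev =>
    hρgood d.rev _ (hgood_even d i hi0 hi hev).1 (hgood_even d i hi0 hi hev).2
  -- one step along a chain is an edge of `B₂` under the fold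
  have hstep : ∀ (d : Dart B) (i : ℕ), i < 2 * n d + 3 → (subdiv B).Adj (ρf (c d i)) (ρf (c d (i + 1))) := by
    intro d i hi
    rcases Nat.eq_zero_or_pos i with rfl | hi0
    · rw [hc0, hρβ, hρodd d 1 (by omega) (by decide), subdiv_adj_inl_inr]
    · by_cases hlast : i + 1 = 2 * n d + 3
      · have hev : Even i := ⟨n d + 1, by omega⟩
        rw [hρeven d i hi0 hi hev, hlast, hcL, hρβ, subdiv_adj_inr_inl]
        rfl
      · by_cases hev : Even i
        · have hodd' : ¬ Even (i + 1) := by rw [Nat.even_add_one]; exact not_not.2 hev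
          rw [hρeven d i hi0 hi hev, hρodd d (i + 1) (by omega) hodd', subdiv_adj_inr_inr, Dart.rev_rev]
        · have hev' : Even (i + 1) := by rw [Nat.even_add_one]; exact hev
          rw [hρodd d i hi hev, hρeven d (i + 1) (by omega) (by omega) hev', subdiv_adj_inr_inr]
  -- the sub-pattern of chain edges
  set E₀ : Multiset (Fin a × Fin b) := E.dedup.filter fun p => ∃ d i, i < 2 * n d + 3 ∧
      ((c d i = Sum.inl p.1 ∧ c d (i + 1) = Sum.inr p.2) ∨ (c d i = Sum.inr p.2 ∧ c d (i + 1) = Sum.inl p.1)) with hE₀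
  have hle : E₀ ≤ E := (Multiset.filter_le _ _).trans (Multiset.dedup_le E)
  -- chain steps are edges of the sub-pattern
  have hadj₀ : ∀ (d : Dart B) (i : ℕ), i < 2 * n d + 3 → (patternGraph E₀).Adj (c d i) (c d (i + 1)) := by
    intro d i hi
    have h := hadj d i hi
    simp only [patternGraph, SimpleGraph.fromRel_adj] at h ⊢
    refine ⟨h.1, ?_⟩
    rcases h.2 with ⟨p, hp, hx, hy⟩ | ⟨p, hp, hx, hy⟩
    · refine Or.inl ⟨p, ?_, hx, hy⟩
      rw [hE₀, Multiset.mem_filter]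
      exact ⟨Multiset.mem_dedup.2 hp, d, i, hi, Or.inl ⟨hx, hy⟩⟩
    · refine Or.inr ⟨p, ?_, hx, hy⟩
      rw [hE₀, Multiset.mem_filter]
      exact ⟨Multiset.mem_dedup.2 hp, d, i, hi, Or.inr ⟨hy, hx⟩⟩
  -- the fold is a homomorphism on the sub-pattern
  have hhom : ∀ x y, (patternGraph E₀).Adj x y → (subdiv B).Adj (ρf x) (ρf y) := by
    intro x y hxy
    simp only [patternGraph, SimpleGraph.fromRel_adj] at hxy
    have key : ∀ p ∈ E₀, (subdiv B).Adj (ρf (Sum.inl p.1)) (ρf (Sum.inr p.2)) := by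
      intro p hp
      rw [hE₀, Multiset.mem_filter] at hp
      obtain ⟨-, d, i, hi, ⟨hx, hy⟩ | ⟨hx, hy⟩⟩ := hp
      · rw [← hx, ← hy]; exact hstep d i hi
      · rw [← hx, ← hy]; exact (hstep d i hi).symm
    rcases hxy.2 with ⟨p, hp, rfl, rfl⟩ | ⟨p, hp, rfl, rfl⟩
    · exact key p hp
    · exact (key p hp).symm
  let ρ₀ : patternGraph E₀ →g subdiv B := ⟨ρf, fun {x y} h => hhom x y h⟩
  -- the pseudo-section
  let s₀ : Fin v ⊕ Dart B → Fin a ⊕ Fin b := fun y =>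
    match y with
    | .inl u => β u
    | .inr d => c d 1
  have hs₁ : ∀ d : Dart B, ρf (c d 1) = .inr d := fun d => hρodd d 1 (by omega) (by decide)
  refine ⟨E₀, hle, ρ₀, s₀, ?_, ?_⟩
  · rintro (u | d)
    · exact hρβ u
    · exact hs₁ d
  · rintro (u | d) (u' | d') hyy'
    · exact absurd hyy' (subdiv_not_adj_inl_inl B u u')
    · -- `u ~ w_{d}`, `u = d.1.1`: one step of the chain of `d`
      rw [subdiv_adj_inl_inr] at hyy'
      subst hyy'
      refine ⟨0, fun i => c d' i, (by show c d' 0 = β d'.1.1; exact hc0 d'), rfl, fun i hi => ?_, fun i hi => ?_,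
        fun i hi => ?_⟩
      · have : i = 0 := by omega
        subst this; exact hadj₀ d' 0 (by omega)
      · have : i = 0 := by omega
        subst this
        show ρf (c d' 0) = _
        rw [hc0, hρβ]
      · have : i = 0 := by omega
        subst this; exact hs₁ d'
    · -- `w_{d} ~ u'`, `u' = d.1.1`: the first step reversed
      rw [subdiv_adj_inr_inl] at hyy'
      subst hyy'
      refine ⟨0, fun i => c d (1 - i), rfl, (by show c d (1 - (2 * 0 + 1)) = β d.1.1; simp [hc0]),
        fun i hi => ?_, fun i hi => ?_, fun i hi => ?_⟩
      · have : i = 0 := by omega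
        subst this
        simpa using (hadj₀ d 0 (by omega)).symm
      · have : i = 0 := by omega
        subst this; exact hs₁ d
      · have : i = 0 := by omega
        subst this
        show ρf (c d (1 - 1)) = _
        rw [Nat.sub_self, hc0, hρβ]
    · -- `w_{d} ~ w_{d.rev}`: the interior of the chain of `d`
      rw [subdiv_adj_inr_inr] at hyy'
      subst hyy'
      refine ⟨n d, fun i => c d (i + 1), rfl, ?_, fun i hi => ?_, fun i hi => ?_, fun i hi => ?_⟩
      · show c d (2 * n d + 1 + 1) = c d.rev 1
        rw [hrev d 1 (by omega)]
        congr 1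
      · exact hadj₀ d (i + 1) (by omega)
      · show ρf (c d (2 * i + 1)) = _
        exact hρodd d _ (by omega) (by rw [Nat.not_even_iff_odd]; exact ⟨i, rfl⟩)
      · show ρf (c d (2 * i + 1 + 1)) = _
        exact hρeven d _ (by omega) (by omega) ⟨i + 1, by ring⟩

/-- **AFFINE WITNESSES FROM CHAINS.**  For `B` connected on `≥ 2` vertices with `tw B ≥ k ≥ 1` and a chain system as in
`oddCover_of_chains` in the pattern graph of `E`: a `HomIndist ν k` pair of points of `ℂ^{ν×ν}`, `ν = |CFI(B)|`, separates
`hom_E`. [cite: Roberson2022, Thm 3.13; ChenFlumLiu2025, Thm 11.1, Thm 12.2; Dvorak2010, Thm 6] -/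
theorem exists_homIndist_affineWitness_of_chains {v a b k : ℕ} {B : SimpleGraph (Fin v)} (E : Multiset (Fin a × Fin b))
    (hconn : B.Connected) (h2 : 2 ≤ v) (hk : 1 ≤ k)
    (htw : k ≤ Literature.Combinatorics.SimpleGraph.treewidth B) (hE : B.edgeSet.Nonempty)
    (β : Fin v → Fin a ⊕ Fin b) (hβ : Function.Injective β) (n : Dart B → ℕ) (c : Dart B → ℕ → Fin a ⊕ Fin b)
    (hn : ∀ d, n d.rev = n d) (hc0 : ∀ d, c d 0 = β d.1.1)
    (hrev : ∀ d i, i ≤ 2 * n d + 3 → c d.rev i = c d (2 * n d + 3 - i))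
    (hadj : ∀ d i, i < 2 * n d + 3 → (patternGraph E).Adj (c d i) (c d (i + 1)))
    (hint : ∀ d i, 0 < i → i < 2 * n d + 3 → ∀ u, c d i ≠ β u)
    (hdisj : ∀ d d' i i', 0 < i → i < 2 * n d + 3 → 0 < i' → i' < 2 * n d' + 3 → c d i = c d' i' →
      d' = d ∨ d' = d.rev) :
    ∃ (ν : ℕ) (z z' : Fin ν × Fin ν → ℂ), ν = Fintype.card (CFIVertex B) ∧ HomIndist ν k z z' ∧
      eval z (homPoly E ν ℂ) ≠ eval z' (homPoly E ν ℂ) := by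
  obtain ⟨E₀, hE₀, ρ₀, s₀, hs₀, hchain₀⟩ :=
    oddCover_of_chains (by omega) E β hβ n c hn hc0 hrev hadj hint hdisj
  obtain ⟨m, X, Y, hm, hXY, hmono, hstrict⟩ := exists_fin_hosts_odd hconn h2 hk htw hE
  refine ⟨m, fun x => Set.indicator {ij : Fin m × Fin m | X.Adj ij.1 ij.2} (1 : Fin m × Fin m → ℂ) x + 1,
    fun x => Set.indicator {ij : Fin m × Fin m | Y.Adj ij.1 ij.2} (1 : Fin m × Fin m → ℂ) x + 1, hm,
    HomIndistShift.homIndist_add_const (SimpleGraphCut.homIndist_indicator_of_ckEquiv hXY) 1, ?_⟩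
  rw [eval_indicator_add_one_homPoly, eval_indicator_add_one_homPoly, Ne, Nat.cast_inj]
  apply ne_of_gt
  obtain ⟨U, hU⟩ := Multiset.le_iff_exists_add.1 hE₀
  have hp₀ : (E₀, U) ∈ Multiset.antidiagonal E := by
    rw [Multiset.mem_antidiagonal, hU]
  exact sum_map_lt_of_le_of_lt _ _ _ (fun p _ => hmono _ (patternGraph p.1)) hp₀
    (hstrict _ (patternGraph E₀) ρ₀ s₀ hs₀ hchain₀)

/-- **THE `√N` RUNG FROM CHAIN SYSTEMS: (CH₂)_{C,g} with `g` polynomially bounded ⇒ `WidthRung (fun n => Nat.sqrt n / (3C+3))`.**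
(CH₂): every isolated-free pattern of tree-width `≥ g k` contains, for some connected base `B` on `≥ 2` vertices with
`tw B ≥ k`, an edge and `|CFI(B)| ≤ C(a+b+1)`, a chain system (odd chains `≥ 3` along the darts, reversed darts reversed,
interiors private).  Same assembly as `widthRung_sqrt_of_oddCovers`. [cite: DawarPagoSeppelt2025, Thm 7.3, Thm 7.9; DawarWilsenach2025, §3.3; Roberson2022, Thm 3.13] -/
theorem widthRung_sqrt_of_chains (C : ℕ) (g : ℕ → ℕ) (e : ℕ) (hg : ∀ k, g k ≤ (k + 2) ^ e)
    (hCH : ∀ (k a b : ℕ) (E : Multiset (Fin a × Fin b)), 1 ≤ k →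
      (∀ u : Fin a, ∃ x ∈ E, x.1 = u) → (∀ w : Fin b, ∃ x ∈ E, x.2 = w) →
      g k ≤ Literature.Combinatorics.SimpleGraph.treewidth (patternGraph E) →
      ∃ (v : ℕ) (B : SimpleGraph (Fin v)), B.Connected ∧ 2 ≤ v ∧
        k ≤ Literature.Combinatorics.SimpleGraph.treewidth B ∧ B.edgeSet.Nonempty ∧
        Fintype.card (CFIVertex B) ≤ C * (a + b + 1) ∧
        ∃ (β : Fin v → Fin a ⊕ Fin b) (n : Dart B → ℕ) (c : Dart B → ℕ → Fin a ⊕ Fin b),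
          Function.Injective β ∧ (∀ d, n d.rev = n d) ∧ (∀ d, c d 0 = β d.1.1) ∧
          (∀ d i, i ≤ 2 * n d + 3 → c d.rev i = c d (2 * n d + 3 - i)) ∧
          (∀ d i, i < 2 * n d + 3 → (patternGraph E).Adj (c d i) (c d (i + 1))) ∧
          (∀ d i, 0 < i → i < 2 * n d + 3 → ∀ u, c d i ≠ β u) ∧
          (∀ d d' i i', 0 < i → i < 2 * n d + 3 → 0 < i' → i' < 2 * n d' + 3 → c d i = c d' i' →
            d' = d ∨ d' = d.rev)) :
    WidthRung fun n => Nat.sqrt n / (3 * C + 3) := by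
  intro f hsym _hVP hdegle hdet
  obtain ⟨c₀, hc₀⟩ := hdet
  obtain ⟨c', hc'⟩ := SmallWitnessRung.exists_polylog_dominates c₀ e
  refine ⟨c' + 3, fun N =>
    IsolationAnyLevel.qpOrbit_of_matrixSymmetric_of_smallDistinguishable₂ f c₀ c' hsym hc₀ (fun n => ?_) N⟩
  have hdeg : (f n).totalDegree * (C * (2 * (f n).totalDegree + 1)) ≤ n := by
    have h0 : (f n).totalDegree ≤ Nat.sqrt n / (3 * C + 3) := hdegle n
    set d := (f n).totalDegree with hd
    set s := Nat.sqrt n with hs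
    have h1 : (3 * C + 3) * d ≤ s :=
      calc (3 * C + 3) * d ≤ (3 * C + 3) * (s / (3 * C + 3)) := Nat.mul_le_mul_left _ h0
        _ ≤ s := Nat.mul_div_le s (3 * C + 3)
    have h2 : s * s ≤ n := Nat.sqrt_le n
    have h3 : d ≤ d * d := by
      rcases Nat.eq_zero_or_pos d with h | h
      · simp [h]
      · exact Nat.le_mul_of_pos_left d h
    have h4 : (3 * C + 3) * d * ((3 * C + 3) * d) ≤ s * s := Nat.mul_le_mul h1 h1
    nlinarith [h1, h2, h3, h4]
  have hk1 : 1 ≤ (Nat.log 2 n + c₀) ^ c₀ := by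
    rcases Nat.eq_zero_or_pos c₀ with h | h
    · simp [h]
    · exact Nat.one_le_pow _ _ (by omega)
  refine ⟨C * (2 * (f n).totalDegree + 1), hdeg, fun a b E ha hb hrow hcol htw => ?_⟩
  obtain ⟨v, B, hconn, h2, htwB, hE, hcard, β, nn, c, hβ, hn, hc0, hrev, hadj, hint, hdisj⟩ :=
    hCH _ a b E hk1 hrow hcol (le_trans ((hg _).trans (hc' (Nat.log 2 n))) htw)
  obtain ⟨ν, z, z', hν, hzz', hne⟩ :=
    exists_homIndist_affineWitness_of_chains E hconn h2 hk1 htwB hE β hβ nn c hn hc0 hrev hadj hint hdisj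
  have hνle : ν ≤ C * (2 * (f n).totalDegree + 1) :=
    (hν ▸ hcard).trans (Nat.mul_le_mul_left C (by omega))
  exact exists_homIndist_witness_mono E hrow hcol hνle ⟨z, z', hzz', hne⟩

end Summit.ValiantsHypothesis.ValiantsHypothesis.Theorems.CFIOddCover

end
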